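import Summits.BirchSwinnertonDyer.Rank1Residual.AdditivePotMult.PotMultChiBranchPrime
import Summits.BirchSwinnertonDyer.Rank1Residual.AdditivePotMult.RankZeroChiBranchImage
import HarnessLib

/-!
# X3♯(M) and X4(M) ∧ surj(p), analytic rank `0`, at EVERY odd prime `p`: the UPPER HALF of `BSD(E,p)`
# CLASS-WIDE from published theorems + kernel glue, and `BSD(E,p)` on the `p ∤ #Ш_an(E)` rows
# (cell `b2b-bsdres`, seat additive-p1, gen 9 — the gen-6/7 any-odd-`p` consumers with their typed input DISCHARGED)

HONEST FRAMING (cell `b2b-bsdres`, run/shared/lean/b2b/bsd-rank1-residual/, verbatim in every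
file): the goal of the cell is to DELETE the COMBINATION-SHAPED residual classes of the
Birch–Swinnerton-Dyer formula for ALL analytic-rank `≤ 1` elliptic curves over `ℚ` — "full BSD
formula for every rank `≤ 1` curve in class `C`" assembled STRICTLY from published theorems — so
that the rank-`≤ 1` remainder becomes exactly the CONSTRUCTION-SHAPED classes, which are TYPED
(missing-input `Prop`s), NOT attempted. This is not "finishing BSD". The additive sub-cell (seats
additive-p1…p4) is a RESEARCH ROUTE on the construction-shaped classes X3/X4; sub-cell additive-p1
= the potentially MULTIPLICATIVE additive prime (X3♯(M) / X4(M)); no claim beyond the stated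
classes; the labels of X3/X4 are UNCHANGED by this file; nothing is booked.

Theorems only (pure compositions; no definition, no named fact minted). The gen-6/7 class theorems
`ClassX3M.missingUpperBoundAt_rankZero_of_chiBranch_of_odd` (p225681), `ClassX4M.missingUpperBoundAt_
rankZero_of_chiBranch_of_surj_of_odd` (p226234), `ClassX4M.…_of_eleven_le` /
`…_of_not_dvd_padicValRat_j_of_odd` (p218920/p226644) took additive-p4's TYPED `χ_p`-branch inputs
`ChiBranchLeadingTerm[Odd][BigImage]At W p` ([B∘C] at `T = 0`, both parities) as hypotheses.
`PotMultChiBranchPrime.lean` proves all four of them for every `W` potentially multiplicative at `p`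
and every odd `p`, from the two general-`p` componentwise reading-facts
`Wuthrich2014.thm16_halfEigenCharIdeal_dvd_cyclotomicPrime` (`hW16`) /
`Wuthrich2014.kato_halfEigenCharIdeal_dvd_cyclotomicPrime_of_surjective` (`hKato`) and the kernel
transport (this seat's bricks 1–3 + additive-p2's `ChiEigenPrimeToPDescent*`). THIS FILE substitutes:

* §1 **X3♯(M) ∧ `r_an(E) = 0`, EVERY odd `p`: `Typed.MissingUpperBoundAt W p` = `ord_p #Ш(E) ≤ ord_p #Ш_an(E)`
  for EVERY such curve** (`ClassX3M.missingUpperBoundAt_rankZero`) — inputs: Delbourgo 1998 Prop. 4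
  (`hDel`), GZK, modularity (`hmod`, `hmodD`), Wuthrich 2014 Thm. 16 on the `ω^{(p−1)/2}`-component
  (`hW16`); NO Tamagawa (`c_p(E) ∈ {1,2,4}`, gen 7), NO Manin, NO image, NO twist-side hypothesis;
  `BSD(E,p)` on the `p ∤ #Ш_an(E)` rows / given the lower half; X3♯ there = EXACTLY the lower half;
* §2 **X4(M) ∧ `r_an(E) = 0` ∧ surj(p), EVERY odd `p`** (`ClassX4M.missingUpperBoundAt_rankZero_of_surj`)
  — inputs `hDel`, `hGZK`, `hmod`, `hmodD`, Wuthrich Lemma 20 (`hL20`, only used at `p = 3`), `hKato`;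
  surj(p) itself decided in the kernel by `p ∤ ord_p j(E)` (`…_of_not_dvd_padicValRat_j`) or by
  `p ≥ 11` (`…_of_eleven_le`, Balakrishnan–…–Bilu–Parent–Rebolledo Thm. 1.2 via `thm12_not_le_normalizer_splitCartan`);
  `BSD(E,p)` on the `p ∤ #Ш_an` rows / given the lower half; X4♯ there = EXACTLY the lower half.

At `p = 3` these coincide with `RankZeroChiBranchThreeFacts.lean` (A122/A123, the `p = 3` members of
the same reading family). What they do NOT give: the LOWER half (SU direction on the
`ω^{(p−1)/2}`-branch — printed nowhere), ranks `≠ 0`. Labels UNCHANGED; X3♯(M)/X4(M) stay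
CONSTRUCTION-SHAPED; nothing booked (referee).

References: Delbourgo 1998 [Delbourgo1998] Prop. 4; Wuthrich 2014 [Wuthrich2014] Thm. 16,
Lemma 20, Cor. 19; Kato 2004 [Kato2004Asterisque] Thm. 17.4; Mazur–Tate–Teitelbaum 1986
[MazurTateTeitelbaum1986Invent] §I.13–I.14; Balakrishnan et al. 2019 [BalakrishnanEtAl2019] Thm. 1.2.
-/

noncomputable section

open scoped Classical

open WeierstrassCurve Literature.NumberTheory.EllipticCurves
  Literature.NumberTheory.EllipticCurves.ModularForms
  Literature.NumberTheory.EllipticCurves.Rank1Residual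
  Literature.NumberTheory.EllipticCurves.Rank1Residual.Typed
  Literature.NumberTheory.EllipticCurves.BalakrishnanEtAl2019

namespace Summit.BirchSwinnertonDyer.Rank1Residual.AdditivePotMult

open Additive GaloisImage

variable {W : WeierstrassCurve ℚ} [W.IsElliptic] [W.IsGloballyMinimal] {p : ℕ} [hp : Fact p.Prime]

/-! ### §1 X3♯(M), every odd `p`, rank `0` -/

/-- **X3♯(M) ∧ `r_an(E) = 0`, ANY odd `p`: the upper half `ord_p #Ш(E) ≤ ord_p #Ш_an(E)` for EVERY
such curve, from published theorems + kernel glue** — Delbourgo 1998 Prop. 4 (`hDel`), GZK,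
modularity (`hmod`, `hmodD`) and Wuthrich 2014 Thm. 16 read on the `ω^{(p−1)/2}`-component over
`ℚ(μ_{p^∞})` (`hW16`), through `PotMult.chiBranchLeadingTerm[Odd]At_of_halfFact` and the gen-7
consumer `ClassX3M.missingUpperBoundAt_rankZero_of_chiBranch_of_odd` (`c_p(E) ∈ {1,2,4}`). No
Tamagawa / Manin / image / twist-side hypothesis. X3♯(M) stays CONSTRUCTION-SHAPED (lower half
printed nowhere); nothing booked. [cite: Delbourgo1998, Prop. 4 (p. 144) and Lemma (ii) (p. 139)]
[cite: Wuthrich2014, Thm. 16 (p. 397) and §3 (p. 390)] -/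
theorem ClassX3M.missingUpperBoundAt_rankZero
    (hDel : Delbourgo1998.prop4_rankZero_pow_dvd_constantCoeff)
    (hGZK : rank_eq_analyticRank_of_analyticRank_le_one) (hmod : hasEntireLFunction_rat)
    (hmodD : nonempty_modularParametrizationData)
    (hW16 : Wuthrich2014.thm16_halfEigenCharIdeal_dvd_cyclotomicPrime)
    (hX : ClassX3M W p) (hr : W.analyticRank = 0) : MissingUpperBoundAt W p :=
  ClassX3M.missingUpperBoundAt_rankZero_of_chiBranch_of_odd hDel hGZK hmod hmodD
    ((ClassX3M.potMult W p hX).chiBranchLeadingTermAt_of_halfFact hW16)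
    ((ClassX3M.potMult W p hX).chiBranchLeadingTermOddAt_of_halfFact hW16) hX hr

/-- **X3♯(M) ∧ `r_an(E) = 0` ∧ `p ∤ #Ш_an(E)`, ANY odd `p`: `BSD(E,p)`** from published theorems +
kernel glue. [cite: Delbourgo1998, Prop. 4 (p. 144)] [cite: Wuthrich2014, Thm. 16 (p. 397)] -/
theorem ClassX3M.bsdp_rankZero_of_shaAn_unit
    (hDel : Delbourgo1998.prop4_rankZero_pow_dvd_constantCoeff)
    (hGZK : rank_eq_analyticRank_of_analyticRank_le_one) (hmod : hasEntireLFunction_rat)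
    (hmodD : nonempty_modularParametrizationData)
    (hW16 : Wuthrich2014.thm16_halfEigenCharIdeal_dvd_cyclotomicPrime)
    (hX : ClassX3M W p) (hr : W.analyticRank = 0)
    {q : ℚ} (hq : shaAn W = (q : ℂ)) (hv : padicValRat p q = 0) : BSDp W p :=
  bsdp_of_missingPPartAt W p hGZK (by rw [hr]; exact zero_le_one)
    (missingPPartAt_of_upper_of_shaAn_unit W p
      (ClassX3M.missingUpperBoundAt_rankZero hDel hGZK hmod hmodD hW16 hX hr) hq hv)

/-- **X3♯(M) ∧ `r_an(E) = 0`, ANY odd `p`: `BSD(E,p)` from the LOWER half `ord_p #Ш_an(E) ≤ ord_p #Ш(E)`.**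
[cite: Delbourgo1998, Prop. 4 (p. 144)] [cite: Wuthrich2014, Thm. 16 (p. 397)] -/
theorem ClassX3M.bsdp_rankZero_of_lower
    (hDel : Delbourgo1998.prop4_rankZero_pow_dvd_constantCoeff)
    (hGZK : rank_eq_analyticRank_of_analyticRank_le_one) (hmod : hasEntireLFunction_rat)
    (hmodD : nonempty_modularParametrizationData)
    (hW16 : Wuthrich2014.thm16_halfEigenCharIdeal_dvd_cyclotomicPrime)
    (hX : ClassX3M W p) (hr : W.analyticRank = 0) (hlow : MissingLowerBoundAt W p) : BSDp W p :=
  bsdp_of_missingPPartAt W p hGZK (by rw [hr]; exact zero_le_one)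
    (missingPPartAt_of_lower_of_upper W p hlow
      (ClassX3M.missingUpperBoundAt_rankZero hDel hGZK hmod hmodD hW16 hX hr))

/-- **X3♯(M) ∧ `r_an(E) = 0`, ANY odd `p`: what remains of X3♯ on these pairs is EXACTLY the lower
half** — `Typed.X3.MissingInputAt W p ⟺ MissingLowerBoundAt W p`.
[cite: Delbourgo1998, Prop. 4 (p. 144)] [cite: Wuthrich2014, Thm. 16 (p. 397)] -/
theorem ClassX3M.missingInputAt_iff_lower_rankZero
    (hDel : Delbourgo1998.prop4_rankZero_pow_dvd_constantCoeff)
    (hGZK : rank_eq_analyticRank_of_analyticRank_le_one) (hmod : hasEntireLFunction_rat)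
    (hmodD : nonempty_modularParametrizationData)
    (hW16 : Wuthrich2014.thm16_halfEigenCharIdeal_dvd_cyclotomicPrime)
    (hX : ClassX3M W p) (hr : W.analyticRank = 0) :
    X3.MissingInputAt W p ↔ MissingLowerBoundAt W p :=
  ⟨fun h ↦ (lower_and_upper_of_missingPPartAt W p h).1, fun h ↦
    missingPPartAt_of_lower_of_upper W p h
      (ClassX3M.missingUpperBoundAt_rankZero hDel hGZK hmod hmodD hW16 hX hr)⟩

/-! ### §2 X4(M) ∧ surj(p), every odd `p`, rank `0` -/

/-- **X4(M) ∧ `r_an(E) = 0` ∧ surj(p), ANY odd `p`: the upper half `ord_p #Ш(E) ≤ ord_p #Ш_an(E)` for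
EVERY such curve, from published theorems + kernel glue** — Delbourgo 1998 Prop. 4 (`hDel`), GZK,
modularity (`hmod`, `hmodD`), Wuthrich 2014 Lemma 20 (`hL20`, used only at `p = 3` for the `3`-adic
image of the multiplicative twist; at `p ≥ 5` Serre) and Kato's divisibility read on the
`ω^{(p−1)/2}`-component over `ℚ(μ_{p^∞})` (`hKato`: Kato 17.4 (3) / Wuthrich Thm. 3–Cor. 19
attribution), through `PotMult.chiBranchLeadingTerm[Odd]BigImageAt_of_halfFact` and the gen-7
consumer `ClassX4M.missingUpperBoundAt_rankZero_of_chiBranch_of_surj_of_odd`. NO `ram`, NO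
Tamagawa, NO Manin, NO `j`-witness hypothesis. X4(M) stays CONSTRUCTION-SHAPED; nothing booked.
[cite: Delbourgo1998, Prop. 4 (p. 144) and Lemma (ii) (p. 139)] [cite: Wuthrich2014, Lemma 20 (p. 399), Thm. 3 (p. 383), Cor. 19 (p. 398)]
[cite: Kato2004Asterisque, Thm. 17.4 (3) (p. 273)] -/
theorem ClassX4M.missingUpperBoundAt_rankZero_of_surj
    (hDel : Delbourgo1998.prop4_rankZero_pow_dvd_constantCoeff)
    (hGZK : rank_eq_analyticRank_of_analyticRank_le_one) (hmod : hasEntireLFunction_rat)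
    (hmodD : nonempty_modularParametrizationData)
    (hL20 : Wuthrich2014.lemma20_surjective_threeAdic_of_semistable)
    (hKato : Wuthrich2014.kato_halfEigenCharIdeal_dvd_cyclotomicPrime_of_surjective)
    (hX : ClassX4M W p) (hr : W.analyticRank = 0) (hsurj : Surj W p) : MissingUpperBoundAt W p :=
  ClassX4M.missingUpperBoundAt_rankZero_of_chiBranch_of_surj_of_odd hDel hGZK hmod hmodD hL20
    ((ClassX4M.potMult W p hX).chiBranchLeadingTermBigImageAt_of_halfFact hKato)
    ((ClassX4M.potMult W p hX).chiBranchLeadingTermOddBigImageAt_of_halfFact hKato) hX hr hsurj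

/-- **X4(M) ∧ `r_an(E) = 0` ∧ surj(p) ∧ `p ∤ #Ш_an(E)`, ANY odd `p`: `BSD(E,p)`** from published theorems
+ kernel glue — the Tamagawa-obstructed rank-zero X4(M) pairs (`p ∣ c_ℓ`, outside Kim 2026 / T-KIM0)
included. [cite: Delbourgo1998, Prop. 4 (p. 144)] [cite: Wuthrich2014, Lemma 20 (p. 399), Cor. 19 (p. 398)]
[cite: Kato2004Asterisque, Thm. 17.4 (3) (p. 273)] -/
theorem ClassX4M.bsdp_rankZero_of_surj_of_shaAn_unit
    (hDel : Delbourgo1998.prop4_rankZero_pow_dvd_constantCoeff)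
    (hGZK : rank_eq_analyticRank_of_analyticRank_le_one) (hmod : hasEntireLFunction_rat)
    (hmodD : nonempty_modularParametrizationData)
    (hL20 : Wuthrich2014.lemma20_surjective_threeAdic_of_semistable)
    (hKato : Wuthrich2014.kato_halfEigenCharIdeal_dvd_cyclotomicPrime_of_surjective)
    (hX : ClassX4M W p) (hr : W.analyticRank = 0) (hsurj : Surj W p)
    {q : ℚ} (hq : shaAn W = (q : ℂ)) (hv : padicValRat p q = 0) : BSDp W p :=
  ClassX4M.bsdp_rankZero_of_chiBranch_of_surj_of_shaAn_unit_of_odd hDel hGZK hmod hmodD hL20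
    ((ClassX4M.potMult W p hX).chiBranchLeadingTermBigImageAt_of_halfFact hKato)
    ((ClassX4M.potMult W p hX).chiBranchLeadingTermOddBigImageAt_of_halfFact hKato) hX hr hsurj hq hv

/-- **X4(M) ∧ `r_an(E) = 0` ∧ surj(p), ANY odd `p`: `BSD(E,p)` from the LOWER half.**
[cite: Delbourgo1998, Prop. 4 (p. 144)] [cite: Wuthrich2014, Lemma 20 (p. 399), Cor. 19 (p. 398)] -/
theorem ClassX4M.bsdp_rankZero_of_surj_of_lower
    (hDel : Delbourgo1998.prop4_rankZero_pow_dvd_constantCoeff)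
    (hGZK : rank_eq_analyticRank_of_analyticRank_le_one) (hmod : hasEntireLFunction_rat)
    (hmodD : nonempty_modularParametrizationData)
    (hL20 : Wuthrich2014.lemma20_surjective_threeAdic_of_semistable)
    (hKato : Wuthrich2014.kato_halfEigenCharIdeal_dvd_cyclotomicPrime_of_surjective)
    (hX : ClassX4M W p) (hr : W.analyticRank = 0) (hsurj : Surj W p)
    (hlow : MissingLowerBoundAt W p) : BSDp W p :=
  ClassX4M.bsdp_rankZero_of_chiBranch_of_surj_of_lower_of_odd hDel hGZK hmod hmodD hL20
    ((ClassX4M.potMult W p hX).chiBranchLeadingTermBigImageAt_of_halfFact hKato)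
    ((ClassX4M.potMult W p hX).chiBranchLeadingTermOddBigImageAt_of_halfFact hKato) hX hr hsurj hlow

/-- **X4(M) ∧ `r_an(E) = 0` ∧ surj(p), ANY odd `p`: what remains of X4♯ is EXACTLY the lower half.**
[cite: Delbourgo1998, Prop. 4 (p. 144)] [cite: Wuthrich2014, Lemma 20 (p. 399), Cor. 19 (p. 398)] -/
theorem ClassX4M.missingInputAt_iff_lower_rankZero_of_surj
    (hDel : Delbourgo1998.prop4_rankZero_pow_dvd_constantCoeff)
    (hGZK : rank_eq_analyticRank_of_analyticRank_le_one) (hmod : hasEntireLFunction_rat)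
    (hmodD : nonempty_modularParametrizationData)
    (hL20 : Wuthrich2014.lemma20_surjective_threeAdic_of_semistable)
    (hKato : Wuthrich2014.kato_halfEigenCharIdeal_dvd_cyclotomicPrime_of_surjective)
    (hX : ClassX4M W p) (hr : W.analyticRank = 0) (hsurj : Surj W p) :
    X4.MissingInputAt W p ↔ MissingLowerBoundAt W p :=
  ClassX4M.missingInputAt_iff_lower_rankZero_of_chiBranch_of_surj_of_odd hDel hGZK hmod hmodD hL20
    ((ClassX4M.potMult W p hX).chiBranchLeadingTermBigImageAt_of_halfFact hKato)
    ((ClassX4M.potMult W p hX).chiBranchLeadingTermOddBigImageAt_of_halfFact hKato) hX hr hsurj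

/-- **X4(M) ∧ `r_an(E) = 0` ∧ `p ∤ ord_p j(E)`, ANY odd `p`: the upper half** — surj(p) decided in
the kernel by `p ∤ ord_p j(E)` (multr1-p2's `ClassX4M.surj_of_not_dvd_padicValRat_j`).
[cite: SilvermanATAEC1994, V.6 Prop. 6.1 (p. 410) and V.5.3] [cite: Wuthrich2014, Lemma 20 (p. 399), Cor. 19 (p. 398)]
[cite: Delbourgo1998, Prop. 4 (p. 144)] -/
theorem ClassX4M.missingUpperBoundAt_rankZero_of_not_dvd_padicValRat_j
    (hDel : Delbourgo1998.prop4_rankZero_pow_dvd_constantCoeff)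
    (hGZK : rank_eq_analyticRank_of_analyticRank_le_one) (hmod : hasEntireLFunction_rat)
    (hmodD : nonempty_modularParametrizationData)
    (hL20 : Wuthrich2014.lemma20_surjective_threeAdic_of_semistable)
    (hKato : Wuthrich2014.kato_halfEigenCharIdeal_dvd_cyclotomicPrime_of_surjective)
    (hX : ClassX4M W p) (hr : W.analyticRank = 0) (hj : ¬ (p : ℤ) ∣ padicValRat p W.j) :
    MissingUpperBoundAt W p :=
  ClassX4M.missingUpperBoundAt_rankZero_of_surj hDel hGZK hmod hmodD hL20 hKato hX hr
    (ClassX4M.surj_of_not_dvd_padicValRat_j hX hj)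

/-- **X4(M) ∧ `r_an(E) = 0` ∧ `p ∤ ord_p j(E)` ∧ `p ∤ #Ш_an(E)`, ANY odd `p`: `BSD(E,p)`.**
[cite: Delbourgo1998, Prop. 4 (p. 144)] [cite: Wuthrich2014, Lemma 20 (p. 399), Cor. 19 (p. 398)] -/
theorem ClassX4M.bsdp_rankZero_of_not_dvd_padicValRat_j_of_shaAn_unit
    (hDel : Delbourgo1998.prop4_rankZero_pow_dvd_constantCoeff)
    (hGZK : rank_eq_analyticRank_of_analyticRank_le_one) (hmod : hasEntireLFunction_rat)
    (hmodD : nonempty_modularParametrizationData)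
    (hL20 : Wuthrich2014.lemma20_surjective_threeAdic_of_semistable)
    (hKato : Wuthrich2014.kato_halfEigenCharIdeal_dvd_cyclotomicPrime_of_surjective)
    (hX : ClassX4M W p) (hr : W.analyticRank = 0) (hj : ¬ (p : ℤ) ∣ padicValRat p W.j)
    {q : ℚ} (hq : shaAn W = (q : ℂ)) (hv : padicValRat p q = 0) : BSDp W p :=
  bsdp_of_missingPPartAt W p hGZK (by rw [hr]; exact zero_le_one)
    (missingPPartAt_of_upper_of_shaAn_unit W p
      (ClassX4M.missingUpperBoundAt_rankZero_of_not_dvd_padicValRat_j hDel hGZK hmod hmodD hL20 hKato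
        hX hr hj) hq hv)

/-- **X4(M) ∧ `r_an(E) = 0`, `p ≥ 11`: the upper half with NO image hypothesis** (surj(p) automatic on
X4(M) for `p ≥ 11`: split-Cartan exclusion `thm12_not_le_normalizer_splitCartan` + Serre, `ClassX4M.surj_of_eleven_le`).
[cite: BalakrishnanEtAl2019, §1 Thm. 1.2 (arXiv:1711.05846 p. 2)] [cite: Delbourgo1998, Prop. 4 (p. 144)]
[cite: Kato2004Asterisque, Thm. 17.4 (3) (p. 273)] -/
theorem ClassX4M.missingUpperBoundAt_rankZero_of_eleven_le
    (hB : thm12_not_le_normalizer_splitCartan)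
    (hDel : Delbourgo1998.prop4_rankZero_pow_dvd_constantCoeff)
    (hGZK : rank_eq_analyticRank_of_analyticRank_le_one) (hmod : hasEntireLFunction_rat)
    (hmodD : nonempty_modularParametrizationData)
    (hKato : Wuthrich2014.kato_halfEigenCharIdeal_dvd_cyclotomicPrime_of_surjective)
    (hX : ClassX4M W p) (hr : W.analyticRank = 0) (h11 : 11 ≤ p) : MissingUpperBoundAt W p :=
  ClassX4M.missingUpperBoundAt_rankZero_of_chiBranch_of_eleven_le hB hDel hGZK hmod hmodD
    ((ClassX4M.potMult W p hX).chiBranchLeadingTermBigImageAt_of_halfFact hKato)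
    ((ClassX4M.potMult W p hX).chiBranchLeadingTermOddBigImageAt_of_halfFact hKato) hX hr h11

/-- **X4(M) ∧ `r_an(E) = 0` ∧ `p ≥ 11` ∧ `p ∤ #Ш_an(E)`: `BSD(E,p)` with NO image hypothesis.**
[cite: BalakrishnanEtAl2019, §1 Thm. 1.2 (arXiv:1711.05846 p. 2)] [cite: Delbourgo1998, Prop. 4 (p. 144)] -/
theorem ClassX4M.bsdp_rankZero_of_eleven_le_of_shaAn_unit
    (hB : thm12_not_le_normalizer_splitCartan)
    (hDel : Delbourgo1998.prop4_rankZero_pow_dvd_constantCoeff)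
    (hGZK : rank_eq_analyticRank_of_analyticRank_le_one) (hmod : hasEntireLFunction_rat)
    (hmodD : nonempty_modularParametrizationData)
    (hKato : Wuthrich2014.kato_halfEigenCharIdeal_dvd_cyclotomicPrime_of_surjective)
    (hX : ClassX4M W p) (hr : W.analyticRank = 0) (h11 : 11 ≤ p)
    {q : ℚ} (hq : shaAn W = (q : ℂ)) (hv : padicValRat p q = 0) : BSDp W p :=
  bsdp_of_missingPPartAt W p hGZK (by rw [hr]; exact zero_le_one)
    (missingPPartAt_of_upper_of_shaAn_unit W p
      (ClassX4M.missingUpperBoundAt_rankZero_of_eleven_le hB hDel hGZK hmod hmodD hKato hX hr h11)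
      hq hv)

end Summit.BirchSwinnertonDyer.Rank1Residual.AdditivePotMult

end
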